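import Mathlib
import HarnessLib
import Summits.CriticalPhenomena.Statement
import Literature.Probability.RandomPlanarGeometry.RestrictionHulls
import Summits.CriticalPhenomena.SAWScalingLimit.Theorems.SAWLoopFugacityFlowSimpleSubseqLimitsPastFuturePinned

/-!
# Scratch (lead c5): the crux's residual `PastFutureAvoidance` ALONE, in ROUTE-FILE vocabulary

Elaboration check that first-entrance slit avoidance (`FarPast.Line.PastFutureAvoidance`, Theorems file
`…SimpleSubseqLimitsFarReturnLine.lean`, p133186) — the statement the planner may paste IN PLACE OF the
crux `SimpleSubseqLimits` in every route that also carries `AvoidanceLimit` and `EventualTight`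
(`RouteResidual.stub_routeResidual : EventualTight → AvoidanceLimit → (SimpleSubseqLimits ↔ PastFutureAvoidance)`,
p138437; `RouteResidual.sawScalingLimit_of_three_inputs : AvoidanceLimit → PastFutureAvoidance → EventualTight →
SAWScalingLimit`) — written with FULLY QUALIFIED Literature names, elaborates in the import/open context of
the route file `Theses/SAWLoopFugacityFlow.lean` (same four imports and `open` lines; the fifth import only
serves the `Iff.rfl` comparison and the example below). It is the first conjunct of c4's
`Lines/slit_avoidance_route_vocab.lean`. Not for landing.
-/

open scoped BigOperators Topology Manifold Classical MeasureTheory ProbabilityTheory Matrix InnerProductSpace ComplexConjugate ContinuousMap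
open Filter Set Function TopologicalSpace MeasureTheory

/-- The item text (paste as the signature of the restated / promoted item). -/
def SAWFirstEntranceSlitAvoidance : Prop :=
  ∀ (D : Literature.Probability.RandomPlanarGeometry.DobrushinDomain) (a b : ℝ → Literature.Probability.LatticeModels.Site 2), Literature.Probability.RandomPlanarGeometry.SAW.IsEndpointApprox D a b → ∀ (q : ℂ) (r θ : ℝ), 0 < r → 0 < θ → ∃ ε r' : ℝ, 0 < ε ∧ r < r' ∧ r' ≤ 5 * r ∧ ∀ᶠ δ in nhdsWithin 0 (Set.Ioi 0), Literature.Probability.RandomPlanarGeometry.SAW.law D.carrier δ (a δ) (b δ) {γ | ∃ v τ t' : unitInterval, v < τ ∧ τ ≤ t' ∧ (⟨γ.walk.toCurve (Literature.Probability.LatticeModels.meshPoint δ)⟩ : Literature.Probability.RandomPlanarGeometry.Curve ℂ) τ ∈ Metric.closedBall q r' ∧ (∀ u : unitInterval, u < τ → (⟨γ.walk.toCurve (Literature.Probability.LatticeModels.meshPoint δ)⟩ : Literature.Probability.RandomPlanarGeometry.Curve ℂ) u ∉ Metric.closedBall q r') ∧ (∀ u : unitInterval, u ≤ v → 5 * r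 < dist ((⟨γ.walk.toCurve (Literature.Probability.LatticeModels.meshPoint δ)⟩ : Literature.Probability.RandomPlanarGeometry.Curve ℂ) u) q) ∧ dist ((⟨γ.walk.toCurve (Literature.Probability.LatticeModels.meshPoint δ)⟩ : Literature.Probability.RandomPlanarGeometry.Curve ℂ) t') ((⟨γ.walk.toCurve (Literature.Probability.LatticeModels.meshPoint δ)⟩ : Literature.Probability.RandomPlanarGeometry.Curve ℂ) v) < ε} ≤ ENNReal.ofReal θ

-- the item text IS `PastFutureAvoidance` (definitional)
example : SAWFirstEntranceSlitAvoidance ↔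
    Summit.CriticalPhenomena.SAWScalingLimit.Theorems.SimpleSubseqLimits.FarPast.Line.PastFutureAvoidance :=
  Iff.rfl

-- glue survives the restatement: the crux from the item + the A-side crux, no tightness, is
-- `Summit.CriticalPhenomena.SAWScalingLimit.Theorems.SimpleSubseqLimits.FarPast.RouteResidual.line_pastFuture_avoidanceLimit`
-- (p138437; and `…RouteResidual.sawScalingLimit_of_three_inputs : AvoidanceLimit → item → EventualTight → SAWScalingLimit`,
-- p138587) — not imported here only to keep this scratch checkable before the farm builds that module.

-- … and the item from the crux under tightness (nothing is lost)
example (hT : Summit.CriticalPhenomena.SAWScalingLimit.Theses.SAWLoopFugacityFlow.EventualTight)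
    (hS : Summit.CriticalPhenomena.SAWScalingLimit.Theses.SAWLoopFugacityFlow.SimpleSubseqLimits) :
    SAWFirstEntranceSlitAvoidance :=
  Summit.CriticalPhenomena.SAWScalingLimit.Theorems.SimpleSubseqLimits.FarPast.Pinned.pastFutureAvoidance_of_crux
    hT hS
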